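import Summits.CriticalPhenomena.PercolationContinuityZ3.Theorems.PercNearOneGluingNoHeavyLowerTailSahiE3HitSlotAttribution
import Literature.Probability.LatticeModels.SahiThirdOrderCorrelation
import Mathlib.Algebra.BigOperators.Ring.Finset
import Mathlib.Algebra.Order.BigOperators.Ring.Finset
import Mathlib.Tactic.Linarith
import Mathlib.Tactic.Ring
import Mathlib.Tactic.Positivity
import HarnessLib
import HarnessLib.Audit

/-!
# `NoHeavyLowerTail` (crux stmt-CriticalPhenomena-4575), Sahi programme P4 (Holley / monotone coupling):
# product weights satisfy the attribution condition — Sahi's `C₃` for a hitting-set slot under every product weight on `2^κ`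

Support file (cell `prim-l12`, seat P4, generation 7; `--supports stmt-CriticalPhenomena-4575`).  No named facts, no sorries; standard
axioms; def-free.

For a product weight `μ(ω) = ∏_{u ∈ ω} θ_u` (`θ ≥ 0`) on `Finset κ` and an injective enumeration `v : ι → κ` of the generators, the
attribution hypothesis (ATT) of `…SahiE3HitSlotAttribution.latticeE3_nonneg_hitting_of_attribution` holds; hence

  `latticeE3_nonneg_hitting_prod`:  `0 ≤ latticeE3 μ {ω | ∃ i, v i ∈ ω} A B`  for all up-sets `A, B`.

This is the hitting-slot case of Kahn's Conjecture 5 / Sahi's `C₃` for product measures (cell P3's `SahiHittingSlot.sahiE_three_hit_nonneg`,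
there in the `prodBernoulli`/`Set ι` formalism) recovered inside the FKG-lattice framework of this seat, as the atoms case of the attribution
theorem.  The key estimate `m(F_⊥)·m(↑{v i}) ≤ Z·m(F_{e_i})` (`mass_bot_mul_mass_mem_le`) is a weight-preserving injection
`(ω₁, ω₂) ↦ (ω₁ ∪ (ω₂ ∩ R'), ω₂ ∖ R')`, `R' =` the other generators: move the other generators hit by `ω₂` into the generator-free `ω₁`.
-/

namespace Summit.CriticalPhenomena.PercolationContinuityZ3.Theorems.SahiE3HitSlotProduct

open Finset Literature.Probability.LatticeModels
open scoped BigOperators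

variable {κ : Type*} [Fintype κ] [DecidableEq κ] {ι : Type*} [Fintype ι] [DecidableEq ι]

omit [Fintype κ] [Fintype ι] [DecidableEq ι] in
/-- Product weights are log-modular, hence log-supermodular. [folklore] -/
theorem prod_lsm (θ : κ → ℝ) (a b : Finset κ) :
    (∏ u ∈ a, θ u) * (∏ u ∈ b, θ u) ≤ (∏ u ∈ a ⊓ b, θ u) * ∏ u ∈ a ⊔ b, θ u := by
  rw [Finset.inf_eq_inter, Finset.sup_eq_union, mul_comm (∏ u ∈ a ∩ b, θ u), Finset.prod_union_inter]

omit [Fintype κ] [DecidableEq κ] [Fintype ι] [DecidableEq ι] in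
/-- Product weights with nonnegative factors are nonnegative. [folklore] -/
theorem prod_nonneg' {θ : κ → ℝ} (hθ : ∀ u, 0 ≤ θ u) : 0 ≤ fun ω : Finset κ => ∏ u ∈ ω, θ u :=
  fun _ => Finset.prod_nonneg fun u _ => hθ u

/-- **The key estimate** `m(F_⊥)·m({ω | v i ∈ ω}) ≤ Z·m(F_{e_i})` for a product weight: a weight-preserving injection from pairs
(generator-free `ω₁`, `ω₂ ∋ v i`) into pairs (anything, `ω₂'` hitting exactly the generator `v i`). [this work] -/
theorem mass_bot_mul_mass_mem_le {θ : κ → ℝ} (hθ : ∀ u, 0 ≤ θ u) {v : ι → κ} (hv : Function.Injective v)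
    {F : (ι → Bool) → Finset (Finset κ)} (hF : ∀ (t : ι → Bool) (ω : Finset κ), ω ∈ F t ↔ ∀ l, (v l ∈ ω ↔ t l = true))
    (i : ι) :
    mass (fun ω : Finset κ => ∏ u ∈ ω, θ u) (F ⊥) * mass (fun ω : Finset κ => ∏ u ∈ ω, θ u) (univ.filter fun ω => v i ∈ ω) ≤
      mass (fun ω : Finset κ => ∏ u ∈ ω, θ u) univ * mass (fun ω : Finset κ => ∏ u ∈ ω, θ u) (F fun l => decide (l = i)) := by
  set μ : Finset κ → ℝ := fun ω => ∏ u ∈ ω, θ u with hμ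
  set R' : Finset κ := (univ.image v).erase (v i) with hR'
  set X : Finset (Finset κ) := univ.filter fun ω => v i ∈ ω with hX
  set φ : Finset κ × Finset κ → Finset κ × Finset κ := fun p => (p.1 ∪ (p.2 ∩ R'), p.2 \ R') with hφ
  have hμ0 : ∀ ω, 0 ≤ μ ω := fun ω => Finset.prod_nonneg fun u _ => hθ u
  have memFbot : ∀ ω, ω ∈ F ⊥ ↔ ∀ l, v l ∉ ω := by
    intro ω; rw [hF]; simp
  have memFe : ∀ ω, ω ∈ F (fun l => decide (l = i)) ↔ ∀ l, (v l ∈ ω ↔ l = i) := by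
    intro ω; rw [hF]; simp
  have hR'mem : ∀ u, u ∈ R' ↔ u ≠ v i ∧ ∃ l, v l = u := by
    intro u; simp [hR', Finset.mem_erase, Finset.mem_image]
  have notR' : ∀ ω, ω ∈ F ⊥ → ∀ u ∈ ω, u ∉ R' := by
    intro ω hω u hu huR
    obtain ⟨-, l, rfl⟩ := (hR'mem u).1 huR
    exact (memFbot ω).1 hω l hu
  -- masses of products as sums over product sets
  have hprod : ∀ S T : Finset (Finset κ), mass μ S * mass μ T = ∑ p ∈ S ×ˢ T, μ p.1 * μ p.2 := by
    intro S T; unfold mass; rw [Finset.sum_mul_sum, Finset.sum_product]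
  rw [hprod, hprod]
  -- (1) `φ` preserves the weight on `F ⊥ ×ˢ X`
  have hw : ∀ p ∈ F ⊥ ×ˢ X, μ p.1 * μ p.2 = μ (φ p).1 * μ (φ p).2 := by
    intro p hp
    rw [Finset.mem_product] at hp
    have h1 : Disjoint p.1 (p.2 ∩ R') := by
      rw [Finset.disjoint_left]
      intro u hu hu'
      exact notR' p.1 hp.1 u hu (Finset.mem_inter.1 hu').2
    have h2 : Disjoint (p.2 \ R') (p.2 ∩ R') := by
      rw [Finset.disjoint_left]; intro u hu hu'; exact (Finset.mem_sdiff.1 hu).2 (Finset.mem_inter.1 hu').2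
    have e2 : p.2 = (p.2 \ R') ∪ (p.2 ∩ R') := by
      ext u; simp only [Finset.mem_union, Finset.mem_sdiff, Finset.mem_inter]; tauto
    simp only [hφ, hμ]
    rw [Finset.prod_union h1]
    conv_lhs => rw [e2, Finset.prod_union h2]
    ring
  -- (2) `φ` is injective on `F ⊥ ×ˢ X`
  have hinj : Set.InjOn φ ↑(F ⊥ ×ˢ X) := by
    intro p hp q hq hpq
    rw [Finset.mem_coe, Finset.mem_product] at hp hq
    simp only [hφ, Prod.mk.injEq] at hpq
    have hp1 : p.1 ∩ R' = ∅ := by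
      ext u; simp only [Finset.mem_inter, Finset.notMem_empty, iff_false, not_and]
      exact fun hu => notR' p.1 hp.1 u hu
    have hq1 : q.1 ∩ R' = ∅ := by
      ext u; simp only [Finset.mem_inter, Finset.notMem_empty, iff_false, not_and]
      exact fun hu => notR' q.1 hq.1 u hu
    -- recover the first components
    have e1 : p.1 = (p.1 ∪ (p.2 ∩ R')) \ R' := by
      ext u; simp only [Finset.mem_sdiff, Finset.mem_union, Finset.mem_inter]
      constructor
      · intro hu; exact ⟨Or.inl hu, fun hR => by
          have : u ∈ p.1 ∩ R' := Finset.mem_inter.2 ⟨hu, hR⟩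
          rw [hp1] at this; exact Finset.notMem_empty u this⟩
      · rintro ⟨h | h, hR⟩
        · exact h
        · exact absurd h.2 hR
    have e1' : q.1 = (q.1 ∪ (q.2 ∩ R')) \ R' := by
      ext u; simp only [Finset.mem_sdiff, Finset.mem_union, Finset.mem_inter]
      constructor
      · intro hu; exact ⟨Or.inl hu, fun hR => by
          have : u ∈ q.1 ∩ R' := Finset.mem_inter.2 ⟨hu, hR⟩
          rw [hq1] at this; exact Finset.notMem_empty u this⟩
      · rintro ⟨h | h, hR⟩
        · exact h
        · exact absurd h.2 hR
    -- recover the second components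
    have e2 : p.2 ∩ R' = (p.1 ∪ (p.2 ∩ R')) ∩ R' := by
      rw [Finset.union_inter_distrib_right, hp1, Finset.empty_union, Finset.inter_assoc, Finset.inter_self]
    have e2' : q.2 ∩ R' = (q.1 ∪ (q.2 ∩ R')) ∩ R' := by
      rw [Finset.union_inter_distrib_right, hq1, Finset.empty_union, Finset.inter_assoc, Finset.inter_self]
    have hfst : p.1 = q.1 := by rw [e1, e1', hpq.1]
    have hsnd : p.2 = q.2 := by
      have a : p.2 ∩ R' = q.2 ∩ R' := by rw [e2, e2', hpq.1]
      have b : p.2 \ R' = q.2 \ R' := hpq.2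
      ext u
      by_cases hu : u ∈ R'
      · have := congrArg (fun s => u ∈ s) a; simp only [Finset.mem_inter, hu, and_true] at this; exact Iff.of_eq this
      · have := congrArg (fun s => u ∈ s) b; simp only [Finset.mem_sdiff, hu, not_false_eq_true, and_true] at this
        exact Iff.of_eq this
    exact Prod.ext hfst hsnd
  -- (3) `φ` maps into `univ ×ˢ F_{e_i}`
  have hmaps : (F ⊥ ×ˢ X).image φ ⊆ univ ×ˢ F (fun l => decide (l = i)) := by
    intro q hq
    rw [Finset.mem_image] at hq
    obtain ⟨p, hp, rfl⟩ := hq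
    rw [Finset.mem_product] at hp ⊢
    refine ⟨Finset.mem_univ _, (memFe _).2 fun l => ?_⟩
    show v l ∈ p.2 \ R' ↔ l = i
    rw [Finset.mem_sdiff, hR'mem]
    constructor
    · rintro ⟨-, hne⟩
      by_contra hli
      exact hne ⟨fun h => hli (hv h), l, rfl⟩
    · intro hli; subst hli
      exact ⟨(Finset.mem_filter.1 hp.2).2, fun h => h.1 rfl⟩
  -- assemble
  calc ∑ p ∈ F ⊥ ×ˢ X, μ p.1 * μ p.2 = ∑ p ∈ F ⊥ ×ˢ X, μ (φ p).1 * μ (φ p).2 := Finset.sum_congr rfl hw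
    _ = ∑ q ∈ (F ⊥ ×ˢ X).image φ, μ q.1 * μ q.2 := (Finset.sum_image (f := fun q => μ q.1 * μ q.2) hinj).symm
    _ ≤ ∑ q ∈ univ ×ˢ F (fun l => decide (l = i)), μ q.1 * μ q.2 :=
        Finset.sum_le_sum_of_subset_of_nonneg hmaps fun q _ _ => mul_nonneg (hμ0 _) (hμ0 _)

/-- **Sahi's `C₃` for a hitting-set slot under every product weight on `2^κ`** (the atoms case of the attribution theorem):
`μ(ω) = ∏_{u∈ω} θ_u` with `θ ≥ 0`, `v : ι → κ` injective, `A, B` up-sets ⟹ `0 ≤ latticeE3 μ {ω | ∃ i, v i ∈ ω} A B`. [this work] -/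
theorem latticeE3_nonneg_hitting_prod [LinearOrder ι] {θ : κ → ℝ} (hθ : ∀ u, 0 ≤ θ u) {v : ι → κ}
    (hv : Function.Injective v) {A B : Finset (Finset κ)} (hA : IsUpperSet (A : Set (Finset κ)))
    (hB : IsUpperSet (B : Set (Finset κ))) :
    0 ≤ latticeE3 (fun ω : Finset κ => ∏ u ∈ ω, θ u) (univ.filter fun ω : Finset κ => ∃ i, v i ∈ ω) A B := by
  set F : (ι → Bool) → Finset (Finset κ) := fun t => univ.filter fun ω : Finset κ => ∀ l, (v l ∈ ω ↔ t l = true) with hFdef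
  have hF : ∀ (t : ι → Bool) (ω : Finset κ), ω ∈ F t ↔ ∀ l, (v l ∈ ω ↔ t l = true) := by
    intro t ω; simp [hFdef]
  refine SahiE3HitSlotAttribution.latticeE3_nonneg_hitting_of_attribution (prod_nonneg' hθ) (prod_lsm θ) v hF hA hB
    fun i => ?_
  have hb0 : 0 ≤ mass (fun ω : Finset κ => ∏ u ∈ ω, θ u) (F ⊥) := mass_nonneg (prod_nonneg' hθ) _
  have he0 : 0 ≤ mass (fun ω : Finset κ => ∏ u ∈ ω, θ u) (F fun l => decide (l = i)) := mass_nonneg (prod_nonneg' hθ) _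
  have hsub : (univ.filter fun ω : Finset κ => v i ∈ ω ∧ ∀ l, l < i → v l ∉ ω) ⊆ univ.filter fun ω : Finset κ => v i ∈ ω := by
    intro ω hω; rw [Finset.mem_filter] at hω ⊢; exact ⟨hω.1, hω.2.1⟩
  have key := mass_bot_mul_mass_mem_le hθ hv hF i
  calc mass (fun ω : Finset κ => ∏ u ∈ ω, θ u) (F ⊥) *
        mass (fun ω : Finset κ => ∏ u ∈ ω, θ u) (univ.filter fun ω : Finset κ => v i ∈ ω ∧ ∀ l, l < i → v l ∉ ω)
      ≤ mass (fun ω : Finset κ => ∏ u ∈ ω, θ u) (F ⊥) *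
        mass (fun ω : Finset κ => ∏ u ∈ ω, θ u) (univ.filter fun ω : Finset κ => v i ∈ ω) :=
          mul_le_mul_of_nonneg_left (mass_mono (prod_nonneg' hθ) hsub) hb0
    _ ≤ mass (fun ω : Finset κ => ∏ u ∈ ω, θ u) univ * mass (fun ω : Finset κ => ∏ u ∈ ω, θ u) (F fun l => decide (l = i)) := key
    _ ≤ _ := by nlinarith [mul_nonneg hb0 he0]

end Summit.CriticalPhenomena.PercolationContinuityZ3.Theorems.SahiE3HitSlotProduct
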